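import Summits.ValiantsHypothesis.ValiantsHypothesis.Cruxes.OrbitDimensionBound.Lines.DegreeLadder

set_option linter.dupNamespace false

/-!
# F4 ON-PATH lemma `S → Rung` for the rung `QuadraticShadow` (ladder `Lines/DegreeLadder.lean`, forward rung g7)

`ValiantsHypothesis → QuadraticShadow`, BY NAME and sorry-free: a p-bounded sequence of `T_Λ`-equivariant quadratic
determinantal representations of `per_n` (gauge `(m_n + Σ L(entries)) · 2^{r_n}`) gives p-bounded circuits for
`(per_n)` (`L(det B) ≤ L(DET_m) + Σ L(B[i,j])`, Berkowitz), i.e. `PER` p-computable, i.e. `VP_ℂ = VNP_ℂ`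
(`isPComputable_perPoly_complex_iff`).  The proof is the ladder's `quadraticShadow_of_summit`
(= `degreeShadow_of_summit 2`); registered as an `aesop` SAFE rule so the tribunal's forward kernel closes
`S → QuadraticShadow` by `intro h; aesop`.  Dial monotonicity (`DegreeShadow.anti`) recorded alongside.
-/

namespace Summit.ValiantsHypothesis.ValiantsHypothesis.Cruxes.OrbitDimensionBound.Degree

/-- **ON-PATH `S → QuadraticShadow`** (F4 name shape `<Rung>_of_<Summit>`). [cite: Burgisser2000, Rem. 2.11] -/
@[aesop safe apply]
theorem QuadraticShadow_of_ValiantsHypothesis : _root_.ValiantsHypothesis → QuadraticShadow :=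
  quadraticShadow_of_summit

/-- Every notch of the dial is on the path: `S → DegreeShadow δ`. [cite: Burgisser2000, Rem. 2.11] -/
@[aesop safe apply]
theorem DegreeShadow_of_ValiantsHypothesis (δ : ℕ) : _root_.ValiantsHypothesis → DegreeShadow δ :=
  degreeShadow_of_summit δ

/-- The kernel's structural test, replayed. -/
example : _root_.ValiantsHypothesis → QuadraticShadow := by
  intro h; aesop

/-- Dial monotonicity: a higher notch implies every lower one (`δ ≤ δ'`). -/
example {δ δ' : ℕ} (h : δ ≤ δ') : DegreeShadow δ' → DegreeShadow δ := DegreeShadow.anti h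

/-- In particular the rung implies the floor's shadow (in the floor's gauge). -/
example : QuadraticShadow → Confusion.CoveringShadow Confusion.powLoss := powShadow_of_quadraticShadow

end Summit.ValiantsHypothesis.ValiantsHypothesis.Cruxes.OrbitDimensionBound.Degree
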